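import Literature.NumberTheory.Transcendental.GaGmSubgroupDegrees
import Literature.NumberTheory.Transcendental.PhilipponZeroEstimateOrder
import HarnessLib

/-!
# The power isogenies `(x, y) ↦ (x, y₁^{k₁}, …, yₙ^{kₙ})` of `G = 𝔾ₐ × 𝔾ₘⁿ`

Topic `Literature/NumberTheory/Transcendental`. Elementary toolkit for the reduction of
Philippon's zero estimate on `G = 𝔾ₐ × 𝔾ₘⁿ ⊂ (ℙ¹)ⁿ⁺¹` with UNEQUAL torus degrees
`(D₀, D₁, …, Dₙ)` (Nesterenko 2003, Prop. 5.1 = Waldschmidt 2000, Thm. 8.1) to the equal-degree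
case `(D₀, K, …, K)` proved in the tree (`GaGm.zero_estimate_exact_subgroup`,
`PhilipponZeroEstimateExact.lean`): pulling a polynomial of multidegree `≤ (D₀, D₁, …, Dₙ)` back
along the isogeny `φ_k(x, y) = (x, y_j^{k_j})` with `k_j D_j ≤ K` gives a polynomial of box degree
`≤ (D₀, K)`, vanishing orders along analytic subgroups are preserved (`dφ_k` is the linear
automorphism `(w₀, v) ↦ (w₀, k_j v_j)` of `Lie G`), `φ_k⁻¹(Σ)` is finite with
`φ_k(φ_k⁻¹(Σ)[n+1]) ⊆ Σ[n+1]`, and a connected algebraic subgroup `V × T_{Φ'}` upstairs is sent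
into the connected algebraic subgroup `V × T_Φ`, `Φ = {χ ; kχ ∈ Φ'}`, with `dφ_k(Lie) = Lie`.
Everything here is PROVED; no named facts.

* `powMap k : GaGm n →* GaGm n`, `powLin k` (its differential, a linear equivalence for
  `k_j ≥ 1`), `powMap_exp : φ_k(exp w) = exp(dφ_k w)`, surjectivity (`powMap_surjective`), finite
  fibres (`finite_preimage_powMap`), `powMap_mem_sumset`;
* `kexp k`, `pullPoly k Q` (the substitution `Y_j ↦ Y_j^{k_j}` on exponents), `coeff`/`support`,
  `pullPoly_ne_zero`, `degreeOf_pullPoly_zero_le`, `degreeOf_pullPoly_succ_le`,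
  **`evalAt_pullPoly`** (`(φ_k^* Q)(g) = Q(φ_k g)`);
* **`vanishesToOrder_pullPoly`** — `ord_{φ g} Q ≥ N` along `exp(W)` implies
  `ord_g (φ^*Q) ≥ N` along `exp(dφ⁻¹ W)` (chain rule for Fréchet jets,
  `ContinuousLinearMap.iteratedFDeriv_comp_right`);
* `kmulHom k : ℤⁿ →+ ℤⁿ` (`χ ↦ (k_j χ_j)`), `ConnAlgSubgroup.isoImage k H'`
  (`addPart` unchanged, `chars = kmulHom⁻¹(chars H')`), `powMap_mem_isoImage`
  (`φ_k(H') ≤ isoImage`), **`torusTangent_isoImage`** / **`tangent_isoImage`**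
  (`Lie(isoImage) = dφ_k(Lie H')`) and the dimension bookkeeping `torusDim_isoImage`,
  `finrank_inf_tangent_isoImage` (`dim(W ∩ Lie isoImage) = dim(dφ⁻¹W ∩ Lie H')`),
  `finrank_comap_powLin`.

## References

* Yu. V. Nesterenko, *Linear forms in logarithms of rational numbers*, in: Diophantine
  Approximation (Cetraro 2000), LNM 1819, Springer 2003, 53–106, §5.1 (the groups
  `G* = 𝔙 × T_Φ`, `T_e(G*) = 𝔙 × 𝓛`, and Prop. 5.1).
* M. Waldschmidt, *Diophantine Approximation on Linear Algebraic Groups*, Grundlehren 326,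
  Springer 2000, Ch. 8 (D. Roy), Thm. 8.1.
* A. Borel, *Linear Algebraic Groups*, 2nd ed., GTM 126 (1991), §8.2–8.5 (tori, characters,
  isogenies).
-/

noncomputable section

open MvPolynomial Module
open scoped Pointwise

namespace Literature.NumberTheory.Transcendental

namespace GaGm

variable {n : ℕ}

/-! ### The isogeny and its differential -/

/-- The power isogeny `φ_k : (x, y) ↦ (x, y₁^{k₁}, …, yₙ^{kₙ})` of `G = 𝔾ₐ × 𝔾ₘⁿ`.
[cite: Borel1991, §8.5 (isogenies of tori)] -/
def powMap (k : Fin n → ℕ) : GaGm n →* GaGm n where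
  toFun g := (g.1, fun j => g.2 j ^ k j)
  map_one' := by ext j <;> simp
  map_mul' g h := by ext j <;> simp [mul_pow]

/-- First coordinate of `φ_k g`. [cite: Borel1991, §8.5] -/
@[simp] theorem powMap_fst (k : Fin n → ℕ) (g : GaGm n) : (powMap k g).1 = g.1 := rfl

/-- Torus coordinates of `φ_k g`. [cite: Borel1991, §8.5] -/
@[simp] theorem powMap_snd (k : Fin n → ℕ) (g : GaGm n) (j : Fin n) : (powMap k g).2 j = g.2 j ^ k j := rfl

/-- The differential `v ↦ (k₁v₁, …, kₙvₙ)` of `y ↦ y^k` on `Lie 𝔾ₘⁿ = ℂⁿ`. [cite: Borel1991, §8.5] -/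
def torLin (k : Fin n → ℕ) : (Fin n → ℂ) →ₗ[ℂ] (Fin n → ℂ) where
  toFun v := fun j => (k j : ℂ) * v j
  map_add' v v' := by ext j; simp [mul_add]
  map_smul' c v := by ext j; simp [mul_left_comm]

/-- Coordinates of `torLin`. [cite: Borel1991, §8.5] -/
@[simp] theorem torLin_apply (k : Fin n → ℕ) (v : Fin n → ℂ) (j : Fin n) : torLin k v j = (k j : ℂ) * v j := rfl

/-- The differential `dφ_k : (w₀, v) ↦ (w₀, k₁v₁, …, kₙvₙ)` of the power isogeny on
`Lie G = ℂ × ℂⁿ`. [cite: Borel1991, §8.5] -/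
def powLin (k : Fin n → ℕ) : (ℂ × (Fin n → ℂ)) →ₗ[ℂ] (ℂ × (Fin n → ℂ)) :=
  (LinearMap.id : ℂ →ₗ[ℂ] ℂ).prodMap (torLin k)

/-- `dφ_k w = (w₀, torLin k v)`. [cite: Borel1991, §8.5] -/
theorem powLin_apply (k : Fin n → ℕ) (w : ℂ × (Fin n → ℂ)) : powLin k w = (w.1, torLin k w.2) := rfl

/-- First coordinate of `dφ_k w`. [cite: Borel1991, §8.5] -/
@[simp] theorem powLin_fst (k : Fin n → ℕ) (w : ℂ × (Fin n → ℂ)) : (powLin k w).1 = w.1 := rfl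

/-- Torus coordinates of `dφ_k w`. [cite: Borel1991, §8.5] -/
@[simp] theorem powLin_snd (k : Fin n → ℕ) (w : ℂ × (Fin n → ℂ)) (j : Fin n) :
    (powLin k w).2 j = (k j : ℂ) * w.2 j := rfl

/-- The `k_j` are non-zero in `ℂ`. [folklore] -/
private theorem natCast_k_ne_zero {k : Fin n → ℕ} (hk : ∀ j, 1 ≤ k j) (j : Fin n) : (k j : ℂ) ≠ 0 := by
  exact_mod_cast (show k j ≠ 0 by have := hk j; omega)

/-- `torLin` is injective when all `k_j ≥ 1`. [cite: Borel1991, §8.5] -/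
theorem torLin_injective {k : Fin n → ℕ} (hk : ∀ j, 1 ≤ k j) : Function.Injective (torLin (n := n) k) := by
  intro v v' h
  funext j
  have := congrFun h j
  simp only [torLin_apply] at this
  exact mul_left_cancel₀ (natCast_k_ne_zero hk j) this

/-- `torLin` is surjective when all `k_j ≥ 1`. [cite: Borel1991, §8.5] -/
theorem torLin_surjective {k : Fin n → ℕ} (hk : ∀ j, 1 ≤ k j) : Function.Surjective (torLin (n := n) k) := by
  intro v
  refine ⟨fun j => v j / (k j : ℂ), funext fun j => ?_⟩
  rw [torLin_apply, mul_div_cancel₀ _ (natCast_k_ne_zero hk j)]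

/-- `dφ_k` is injective when all `k_j ≥ 1`. [cite: Borel1991, §8.5] -/
theorem powLin_injective {k : Fin n → ℕ} (hk : ∀ j, 1 ≤ k j) : Function.Injective (powLin (n := n) k) := by
  intro w w' h
  have h1 := congrArg Prod.fst h
  have h2 := congrArg Prod.snd h
  rw [powLin_apply, powLin_apply] at h1 h2
  exact Prod.ext h1 (torLin_injective hk h2)

/-- `dφ_k` is surjective when all `k_j ≥ 1`. [cite: Borel1991, §8.5] -/
theorem powLin_surjective {k : Fin n → ℕ} (hk : ∀ j, 1 ≤ k j) : Function.Surjective (powLin (n := n) k) := by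
  intro w
  obtain ⟨v, hv⟩ := torLin_surjective hk w.2
  exact ⟨(w.1, v), by rw [powLin_apply, hv]⟩

/-- **`φ_k ∘ exp = exp ∘ dφ_k`**: `(e^{v_j})^{k_j} = e^{k_j v_j}`. [cite: Borel1991, §8.5] -/
theorem powMap_exp (k : Fin n → ℕ) (w : ℂ × (Fin n → ℂ)) : powMap k (exp w) = exp (powLin k w) := by
  ext j
  · rfl
  · simp [exp, powMap, ← Complex.exp_nat_mul]

/-- `φ_k` is surjective on `G(ℂ)` (every unit of `ℂ` is a `k`-th power, `k ≥ 1`).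
[cite: Borel1991, §8.5] -/
theorem powMap_surjective {k : Fin n → ℕ} (hk : ∀ j, 1 ≤ k j) : Function.Surjective (powMap (n := n) k) := by
  intro g
  have hroot : ∀ j, ∃ u : ℂˣ, u ^ k j = g.2 j := fun j => by
    obtain ⟨z, hz⟩ := IsAlgClosed.exists_pow_nat_eq ((g.2 j : ℂˣ) : ℂ) (hk j)
    have hz0 : z ≠ 0 := by
      rintro rfl
      rw [zero_pow (by have := hk j; omega)] at hz
      exact (g.2 j).ne_zero hz.symm
    exact ⟨Units.mk0 z hz0, Units.ext (by simpa using hz)⟩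
  choose u hu using hroot
  exact ⟨(g.1, u), by ext j <;> simp [hu]⟩

/-- The fibres of `φ_k` are finite (`k_j ≥ 1`): each torus coordinate of a preimage is a root of
`X^{k_j} - c`. [cite: Borel1991, §8.5] -/
theorem finite_preimage_powMap_singleton {k : Fin n → ℕ} (hk : ∀ j, 1 ≤ k j) (σ : GaGm n) :
    (powMap k ⁻¹' {σ}).Finite := by
  classical
  -- the finite sets of `k_j`-th roots of the coordinates
  have hfin : ∀ j, {u : ℂˣ | u ^ k j = σ.2 j}.Finite := fun j => by
    have h := (Polynomial.nthRoots (k j) ((σ.2 j : ℂˣ) : ℂ)).toFinset.finite_toSet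
    refine (h.preimage (Units.val_injective.injOn)).subset fun u hu => ?_
    simp only [Set.mem_preimage, Finset.mem_coe, Multiset.mem_toFinset]
    rw [Polynomial.mem_nthRoots (hk j)]
    have := congrArg Units.val hu
    simpa using this
  have hpi : (Set.univ.pi fun j => {u : ℂˣ | u ^ k j = σ.2 j}).Finite := Set.Finite.pi fun j => hfin j
  refine ((Set.finite_singleton σ.1).prod hpi).subset ?_
  rintro g hg
  simp only [Set.mem_preimage, Set.mem_singleton_iff] at hg
  refine ⟨by rw [← hg]; rfl, Set.mem_univ_pi.mpr fun j => ?_⟩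
  show g.2 j ^ k j = σ.2 j
  rw [← hg]; rfl

/-- `φ_k⁻¹(Σ)` is finite for finite `Σ`. [cite: Borel1991, §8.5] -/
theorem finite_preimage_powMap {k : Fin n → ℕ} (hk : ∀ j, 1 ≤ k j) {S : Set (GaGm n)} (hS : S.Finite) :
    (powMap k ⁻¹' S).Finite := by
  have : powMap k ⁻¹' S = ⋃ σ ∈ S, powMap k ⁻¹' {σ} := by
    ext g; simp
  rw [this]
  exact hS.biUnion fun σ _ => finite_preimage_powMap_singleton hk σ

/-- `φ_k` maps `Σ'(N)` into `Σ(N)` when `φ_k(Σ') ⊆ Σ` (`φ_k` is a homomorphism). [cite: Borel1991, §8.5] -/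
theorem powMap_mem_sumset (k : Fin n → ℕ) {S S' : Set (GaGm n)} (hS' : S' ⊆ powMap k ⁻¹' S) {N : ℕ}
    {g : GaGm n} (hg : g ∈ sumset S' N) : powMap k g ∈ sumset S N := by
  obtain ⟨σ, hσ, rfl⟩ := hg
  exact ⟨fun i => powMap k (σ i), fun i => hS' (hσ i), by rw [map_prod]⟩

/-! ### Pulling polynomials back along the isogeny -/

/-- The exponent map of `φ_k^*`: `(s₀, s₁, …, sₙ) ↦ (s₀, k₁s₁, …, kₙsₙ)`. [cite: Borel1991, §8.5] -/
def kexp (k : Fin n → ℕ) (s : Fin (n + 1) →₀ ℕ) : Fin (n + 1) →₀ ℕ :=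
  Finsupp.equivFunOnFinite.symm fun i => (Fin.cons (1 : ℕ) k : Fin (n + 1) → ℕ) i * s i

/-- Coordinates of `kexp`. [cite: Borel1991, §8.5] -/
theorem kexp_apply (k : Fin n → ℕ) (s : Fin (n + 1) →₀ ℕ) (i : Fin (n + 1)) :
    kexp k s i = (Fin.cons (1 : ℕ) k : Fin (n + 1) → ℕ) i * s i := by
  simp [kexp]

/-- `kexp` fixes the `X`-exponent. [cite: Borel1991, §8.5] -/
@[simp] theorem kexp_zero (k : Fin n → ℕ) (s : Fin (n + 1) →₀ ℕ) : kexp k s 0 = s 0 := by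
  rw [kexp_apply]; simp

/-- `kexp` multiplies the `Y_j`-exponent by `k_j`. [cite: Borel1991, §8.5] -/
@[simp] theorem kexp_succ (k : Fin n → ℕ) (s : Fin (n + 1) →₀ ℕ) (j : Fin n) :
    kexp k s j.succ = k j * s j.succ := by
  rw [kexp_apply]; simp

/-- `kexp` is injective when all `k_j ≥ 1`. [cite: Borel1991, §8.5] -/
theorem kexp_injective {k : Fin n → ℕ} (hk : ∀ j, 1 ≤ k j) : Function.Injective (kexp k) := by
  intro s s' h
  ext i
  refine Fin.cases ?_ (fun j => ?_) i
  · have := congrArg (fun t => t 0) h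
    simpa using this
  · have := congrArg (fun t => t j.succ) h
    simp only [kexp_succ] at this
    exact Nat.eq_of_mul_eq_mul_left (hk j) this

/-- **The pullback `φ_k^* Q = Q(X, Y₁^{k₁}, …, Yₙ^{kₙ})`** of an affine polynomial along the power
isogeny, defined on exponents. [cite: Borel1991, §8.5] -/
def pullPoly (k : Fin n → ℕ) (Q : MvPolynomial (Fin (n + 1)) ℂ) : MvPolynomial (Fin (n + 1)) ℂ :=
  AddMonoidAlgebra.mapDomain (kexp k) Q

/-- Coefficients of the pullback at pulled-back exponents. [cite: Borel1991, §8.5] -/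
theorem coeff_pullPoly_kexp {k : Fin n → ℕ} (hk : ∀ j, 1 ≤ k j) (Q : MvPolynomial (Fin (n + 1)) ℂ)
    (s : Fin (n + 1) →₀ ℕ) : (pullPoly k Q).coeff (kexp k s) = Q.coeff s := by
  change Finsupp.mapDomain (kexp k) (AddMonoidAlgebra.coeff Q) (kexp k s) = (AddMonoidAlgebra.coeff Q) s
  exact Finsupp.mapDomain_apply (kexp_injective hk) _ s

/-- The support of the pullback. [cite: Borel1991, §8.5] -/
theorem support_pullPoly {k : Fin n → ℕ} (hk : ∀ j, 1 ≤ k j) (Q : MvPolynomial (Fin (n + 1)) ℂ) :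
    (pullPoly k Q).support = Q.support.image (kexp k) := by
  classical
  change (Finsupp.mapDomain (kexp k) (AddMonoidAlgebra.coeff Q)).support = (AddMonoidAlgebra.coeff Q).support.image (kexp k)
  exact Finsupp.mapDomain_support_of_injective (kexp_injective hk) _

/-- The pullback of a non-zero polynomial is non-zero. [cite: Borel1991, §8.5] -/
theorem pullPoly_ne_zero {k : Fin n → ℕ} (hk : ∀ j, 1 ≤ k j) {Q : MvPolynomial (Fin (n + 1)) ℂ} (hQ : Q ≠ 0) :
    pullPoly k Q ≠ 0 := by
  intro h
  apply hQ
  have hinj := AddMonoidAlgebra.mapDomain_injective (R := ℂ) (kexp_injective hk)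
  have h0 : pullPoly k (0 : MvPolynomial (Fin (n + 1)) ℂ) = 0 := AddMonoidAlgebra.mapDomain_zero _
  exact hinj (h.trans h0.symm)

/-- `deg_X (φ_k^* Q) ≤ deg_X Q`. [cite: Borel1991, §8.5] -/
theorem degreeOf_pullPoly_zero_le {k : Fin n → ℕ} (hk : ∀ j, 1 ≤ k j) (Q : MvPolynomial (Fin (n + 1)) ℂ) :
    (pullPoly k Q).degreeOf 0 ≤ Q.degreeOf 0 := by
  classical
  rw [degreeOf_le_iff]
  intro s hs
  rw [support_pullPoly hk, Finset.mem_image] at hs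
  obtain ⟨s, hs, rfl⟩ := hs
  rw [kexp_zero]
  exact monomial_le_degreeOf 0 hs

/-- `deg_{Y_j} (φ_k^* Q) ≤ k_j · deg_{Y_j} Q`. [cite: Borel1991, §8.5] -/
theorem degreeOf_pullPoly_succ_le {k : Fin n → ℕ} (hk : ∀ j, 1 ≤ k j) (Q : MvPolynomial (Fin (n + 1)) ℂ)
    (j : Fin n) : (pullPoly k Q).degreeOf j.succ ≤ k j * Q.degreeOf j.succ := by
  classical
  rw [degreeOf_le_iff]
  intro s hs
  rw [support_pullPoly hk, Finset.mem_image] at hs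
  obtain ⟨s, hs, rfl⟩ := hs
  rw [kexp_succ]
  exact Nat.mul_le_mul_left _ (monomial_le_degreeOf j.succ hs)

/-- **`(φ_k^* Q)(g) = Q(φ_k g)`.** [cite: Borel1991, §8.5] -/
theorem evalAt_pullPoly {k : Fin n → ℕ} (hk : ∀ j, 1 ≤ k j) (Q : MvPolynomial (Fin (n + 1)) ℂ) (g : GaGm n) :
    evalAt (pullPoly k Q) g = evalAt Q (powMap k g) := by
  classical
  rw [evalAt_eq_sum, evalAt_eq_sum, support_pullPoly hk,
    Finset.sum_image fun s _ s' _ h => kexp_injective hk h]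
  refine Finset.sum_congr rfl fun s _ => ?_
  rw [coeff_pullPoly_kexp hk, kexp_zero, powMap_fst]
  congr 2
  simp only [charVal, kexp_succ, powMap_snd, pow_mul, Units.val_pow_eq_pow_val]

/-! ### Vanishing orders are preserved -/

/-- **Pull-back of vanishing orders along the isogeny.** If `Q` vanishes to order `≥ N` at
`φ_k g` along `exp_G(W)`, then `φ_k^* Q` vanishes to order `≥ N` at `g` along
`exp_G(dφ_k⁻¹ W)`: `w' ↦ (φ_k^*Q)(g · exp w') = Q(φ_k g · exp(dφ_k w'))` is the composite of
`w ↦ Q(φ_k g · exp w)` with the linear map `dφ_k : dφ_k⁻¹W → W`, and Fréchet jets of a composite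
with a continuous linear map are the composed jets. [cite: Waldschmidt2000GL326, Thm 8.1] -/
theorem vanishesToOrder_pullPoly {k : Fin n → ℕ} (hk : ∀ j, 1 ≤ k j) {Q : MvPolynomial (Fin (n + 1)) ℂ}
    {W : Submodule ℂ (ℂ × (Fin n → ℂ))} {g : GaGm n} {N : ℕ}
    (h : VanishesToOrder Q W (powMap k g) N) :
    VanishesToOrder (pullPoly k Q) (W.comap (powLin k)) g N := by
  intro i hi
  set W' : Submodule ℂ (ℂ × (Fin n → ℂ)) := W.comap (powLin k) with hW'
  -- `dφ_k` restricted: `W' →L[ℂ] W`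
  let A : ↥W' →L[ℂ] ↥W :=
    LinearMap.toContinuousLinearMap (((powLin k).domRestrict W').codRestrict W fun w => w.2)
  have hA : ∀ w : ↥W', ((A w : ↥W) : ℂ × (Fin n → ℂ)) = powLin k w := fun w => rfl
  set f : ↥W → ℂ := fun w => evalAt Q (powMap k g * exp (w : ℂ × (Fin n → ℂ))) with hf
  have hcomp : (fun w : ↥W' => evalAt (pullPoly k Q) (g * exp (w : ℂ × (Fin n → ℂ)))) = f ∘ A := by
    funext w
    simp only [Function.comp_apply, hf]
    rw [evalAt_pullPoly hk, map_mul, powMap_exp, ← hA]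
  have hfd : ContDiff ℂ i f := by
    have e : f = (fun w : ℂ × (Fin n → ℂ) => evalAt Q (powMap k g * exp w)) ∘ W.subtypeL := funext fun w => rfl
    rw [e]
    exact (contDiff_evalAt_mul_exp Q (powMap k g)).comp W.subtypeL.contDiff
  rw [hcomp, ContinuousLinearMap.iteratedFDeriv_comp_right A hfd _ le_rfl, map_zero]
  have h0 : iteratedFDeriv ℂ i f 0 = 0 := h i hi
  rw [h0]
  ext u
  simp

/-! ### Characters and the image subgroup -/

/-- The pull-back of characters along `φ_k`: `χ ↦ kχ = (k₁χ₁, …, kₙχₙ)` on `X(𝔾ₘⁿ) = ℤⁿ`.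
[cite: Borel1991, §8.5] -/
def kmulHom (k : Fin n → ℕ) : (Fin n → ℤ) →+ (Fin n → ℤ) where
  toFun χ := fun j => (k j : ℤ) * χ j
  map_zero' := by ext j; simp
  map_add' χ χ' := by ext j; simp [mul_add]

/-- Coordinates of `kmulHom`. [cite: Borel1991, §8.5] -/
@[simp] theorem kmulHom_apply (k : Fin n → ℕ) (χ : Fin n → ℤ) (j : Fin n) : kmulHom k χ j = (k j : ℤ) * χ j := rfl

/-- `kmulHom` is injective when all `k_j ≥ 1`. [cite: Borel1991, §8.5] -/
theorem kmulHom_injective {k : Fin n → ℕ} (hk : ∀ j, 1 ≤ k j) : Function.Injective (kmulHom (n := n) k) := by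
  intro χ χ' h
  funext j
  have := congrFun h j
  simp only [kmulHom_apply] at this
  have hkj : (k j : ℤ) ≠ 0 := by exact_mod_cast (show k j ≠ 0 by have := hk j; omega)
  exact mul_left_cancel₀ hkj this

/-- **`χ ∘ φ_k = kχ`**: `(φ_k g)^χ = g^{kχ}` on torus coordinates. [cite: Borel1991, §8.5] -/
theorem prod_zpow_powMap (k : Fin n → ℕ) (g : GaGm n) (χ : Fin n → ℤ) :
    ∏ j, ((powMap k g).2 j) ^ (χ j) = ∏ j, (g.2 j) ^ (kmulHom k χ j) := by
  refine Finset.prod_congr rfl fun j _ => ?_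
  rw [powMap_snd, kmulHom_apply, zpow_mul, zpow_natCast]

namespace ConnAlgSubgroup

/-- **The image of `H' = V × T_{Φ'}` under `φ_k`**: the connected algebraic subgroup `V × T_Φ`
with the same additive part and character lattice `Φ = {χ ; kχ ∈ Φ'}` (saturated because `Φ'`
is). [cite: Nesterenko2003, §5.1 (`G* = 𝔙 × T_Φ`)] -/
def isoImage (k : Fin n → ℕ) (H' : ConnAlgSubgroup n) : ConnAlgSubgroup n where
  addPart := H'.addPart
  chars := H'.chars.comap (kmulHom k)
  saturated := by
    intro c χ hc h
    rw [AddSubgroup.mem_comap] at h ⊢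
    rw [map_zsmul] at h
    exact H'.saturated c _ hc h

/-- The additive part of the image. [cite: Nesterenko2003, §5.1] -/
@[simp] theorem addPart_isoImage (k : Fin n → ℕ) (H' : ConnAlgSubgroup n) : (isoImage k H').addPart = H'.addPart := rfl

/-- The additive dimension of the image. [cite: Nesterenko2003, §5.1] -/
@[simp] theorem addDim_isoImage (k : Fin n → ℕ) (H' : ConnAlgSubgroup n) : (isoImage k H').addDim = H'.addDim := rfl

/-- The characters of the image: `χ ∈ Φ ↔ kχ ∈ Φ'`. [cite: Nesterenko2003, §5.1] -/
theorem mem_chars_isoImage (k : Fin n → ℕ) (H' : ConnAlgSubgroup n) (χ : Fin n → ℤ) :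
    χ ∈ (isoImage k H').chars ↔ kmulHom k χ ∈ H'.chars := Iff.rfl

/-- The character lattice of the image is the pull-back lattice. [cite: Nesterenko2003, §5.1] -/
theorem chars_isoImage (k : Fin n → ℕ) (H' : ConnAlgSubgroup n) :
    (isoImage k H').chars = H'.chars.comap (kmulHom k) := rfl

/-- **`φ_k(H') ≤ isoImage k H'`.** [cite: Borel1991, §8.5] -/
theorem powMap_mem_isoImage (k : Fin n → ℕ) (H' : ConnAlgSubgroup n) {g : GaGm n} (hg : g ∈ H'.toSubgroup) :
    powMap k g ∈ (isoImage k H').toSubgroup := by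
  obtain ⟨hadd, hch⟩ := hg
  refine ⟨fun h => hadd h, fun χ hχ => ?_⟩
  rw [prod_zpow_powMap]
  exact hch _ ((mem_chars_isoImage k H' χ).mp hχ)

/-- **`Lie T_Φ = dφ_k(Lie T_{Φ'})`** for the torus parts: `{v ; ⟨χ, v⟩ = 0 ∀ χ ∈ Φ}` is the image
of `{v' ; ⟨ψ, v'⟩ = 0 ∀ ψ ∈ Φ'}` under `v' ↦ (k_j v'_j)` (`⊇`: `⟨χ, kv'⟩ = ⟨kχ, v'⟩`; `⊆`: for
`ψ ∈ Φ'`, `(∏ₗ kₗ)·ψ = kχ` with `χ ∈ Φ`). [cite: Nesterenko2003, §5.1 (`T_e(G*) = 𝔙 × 𝓛`)] -/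
theorem torusTangent_isoImage {k : Fin n → ℕ} (hk : ∀ j, 1 ≤ k j) (H' : ConnAlgSubgroup n) :
    (isoImage k H').torusTangent = H'.torusTangent.map (torLin k) := by
  ext v
  rw [Submodule.mem_map]
  constructor
  · intro hv
    -- `v' = (v_j / k_j)`
    refine ⟨fun j => v j / (k j : ℂ), fun ψ hψ => ?_, funext fun j => ?_⟩
    · -- `N = ∏ k_l`, `χ_j = (N / k_j) ψ_j`, `kχ = Nψ ∈ Φ'`
      set N : ℕ := ∏ l, k l with hN
      have hNdvd : ∀ j, k j ∣ N := fun j => Finset.dvd_prod_of_mem k (Finset.mem_univ j)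
      have hN0 : (N : ℂ) ≠ 0 := by
        rw [hN, Nat.cast_prod]
        exact Finset.prod_ne_zero_iff.mpr fun l _ => natCast_k_ne_zero hk l
      set χ : Fin n → ℤ := fun j => ((N / k j : ℕ) : ℤ) * ψ j with hχ
      have hkχ : kmulHom k χ = (N : ℤ) • ψ := by
        funext j
        simp only [kmulHom_apply, hχ, Pi.smul_apply, smul_eq_mul, ← mul_assoc]
        congr 1
        rw [← Nat.cast_mul, Nat.mul_div_cancel' (hNdvd j)]
      have hχmem : χ ∈ (isoImage k H').chars := by
        rw [mem_chars_isoImage, hkχ]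
        exact H'.chars.zsmul_mem hψ _
      have h0 := hv χ hχmem
      -- `∑ χ_j v_j = N · ∑ ψ_j v_j / k_j`
      have hterm : ∀ j, (χ j : ℂ) * v j = (N : ℂ) * ((ψ j : ℂ) * (v j / (k j : ℂ))) := fun j => by
        have hvj : v j = (k j : ℂ) * (v j / (k j : ℂ)) := (mul_div_cancel₀ _ (natCast_k_ne_zero hk j)).symm
        have hc : ((N / k j : ℕ) : ℂ) * (k j : ℂ) = N := by
          rw [← Nat.cast_mul, Nat.div_mul_cancel (hNdvd j)]
        calc (χ j : ℂ) * v j = ((N / k j : ℕ) : ℂ) * (ψ j : ℂ) * ((k j : ℂ) * (v j / (k j : ℂ))) := by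
              rw [← hvj]; simp only [hχ, Int.cast_mul, Int.cast_natCast]
          _ = (((N / k j : ℕ) : ℂ) * (k j : ℂ)) * ((ψ j : ℂ) * (v j / (k j : ℂ))) := by ring
          _ = (N : ℂ) * ((ψ j : ℂ) * (v j / (k j : ℂ))) := by rw [hc]
      have hsum : ∑ j, (χ j : ℂ) * v j = (N : ℂ) * ∑ j, (ψ j : ℂ) * (v j / (k j : ℂ)) := by
        rw [Finset.mul_sum]
        exact Finset.sum_congr rfl fun j _ => hterm j
      rw [hsum] at h0
      exact (mul_eq_zero.mp h0).resolve_left hN0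
    · rw [torLin_apply, mul_div_cancel₀ _ (natCast_k_ne_zero hk j)]
  · rintro ⟨v', hv', rfl⟩ χ hχ
    rw [mem_chars_isoImage] at hχ
    have h0 := hv' _ hχ
    simp only [kmulHom_apply, Int.cast_mul, Int.cast_natCast] at h0
    rw [← h0]
    exact Finset.sum_congr rfl fun j _ => by rw [torLin_apply]; ring

/-- **`Lie(isoImage k H') = dφ_k(Lie H')`.** [cite: Nesterenko2003, §5.1 (`T_e(G*) = 𝔙 × 𝓛`)] -/
theorem tangent_isoImage {k : Fin n → ℕ} (hk : ∀ j, 1 ≤ k j) (H' : ConnAlgSubgroup n) :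
    (isoImage k H').tangent = H'.tangent.map (powLin k) := by
  rw [tangent, tangent, powLin, LinearMap.prodMap_map_prod, Submodule.map_id, torusTangent_isoImage hk,
    addPart_isoImage]

/-- The torus dimension is preserved: `dim T_Φ = dim T_{Φ'}`. [cite: Nesterenko2003, §5.1] -/
theorem torusDim_isoImage {k : Fin n → ℕ} (hk : ∀ j, 1 ≤ k j) (H' : ConnAlgSubgroup n) :
    (isoImage k H').torusDim = H'.torusDim := by
  rw [torusDim, torusDim, torusTangent_isoImage hk]
  exact LinearEquiv.finrank_eq (Submodule.equivMapOfInjective _ (torLin_injective hk) _).symm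

/-- **`dim(W ∩ Lie(isoImage k H')) = dim(dφ_k⁻¹W ∩ Lie H')`.** [cite: Nesterenko2003, §5.1] -/
theorem finrank_inf_tangent_isoImage {k : Fin n → ℕ} (hk : ∀ j, 1 ≤ k j) (H' : ConnAlgSubgroup n)
    (W : Submodule ℂ (ℂ × (Fin n → ℂ))) :
    finrank ℂ ↥(W ⊓ (isoImage k H').tangent) = finrank ℂ ↥(W.comap (powLin k) ⊓ H'.tangent) := by
  have hW : W = (W.comap (powLin k)).map (powLin k) :=
    (Submodule.map_comap_eq_of_surjective (powLin_surjective hk) W).symm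
  rw [tangent_isoImage hk, hW, ← Submodule.map_inf _ (powLin_injective hk), ← hW]
  exact LinearEquiv.finrank_eq (Submodule.equivMapOfInjective _ (powLin_injective hk) _).symm

end ConnAlgSubgroup

/-- `dim dφ_k⁻¹W = dim W`. [cite: Nesterenko2003, §5.1] -/
theorem finrank_comap_powLin {k : Fin n → ℕ} (hk : ∀ j, 1 ≤ k j) (W : Submodule ℂ (ℂ × (Fin n → ℂ))) :
    finrank ℂ ↥(W.comap (powLin k)) = finrank ℂ ↥W := by
  have hW : (W.comap (powLin k)).map (powLin k) = W :=
    Submodule.map_comap_eq_of_surjective (powLin_surjective hk) W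
  conv_rhs => rw [← hW]
  exact LinearEquiv.finrank_eq (Submodule.equivMapOfInjective _ (powLin_injective hk) _)

/-- **The codimension `ℓ₀ = dim W − dim(W ∩ Lie H)` is preserved**: for `H = isoImage k H'` and
`W' = dφ_k⁻¹ W`, `dim W − dim(W ∩ Lie H) = dim W' − dim(W' ∩ Lie H')`.
[cite: Nesterenko2003, Prop 5.1 (`ℓ₀`)] -/
theorem codim_isoImage {k : Fin n → ℕ} (hk : ∀ j, 1 ≤ k j) (H' : ConnAlgSubgroup n)
    (W : Submodule ℂ (ℂ × (Fin n → ℂ))) :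
    finrank ℂ ↥W - finrank ℂ ↥(W ⊓ (ConnAlgSubgroup.isoImage k H').tangent) =
      finrank ℂ ↥(W.comap (powLin k)) - finrank ℂ ↥(W.comap (powLin k) ⊓ H'.tangent) := by
  rw [ConnAlgSubgroup.finrank_inf_tangent_isoImage hk, finrank_comap_powLin hk]

end GaGm

end Literature.NumberTheory.Transcendental
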